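import Summits.Ventures.YMGap.Thresholds.LatticeBakryEmeryFrame
import HarnessLib

/-!
# Venture YMGap — multi-link Bakry–Émery calculus, Part F1:
# polynomial functions on `(E → M_N(ℂ))` (finite-dimensional `Δ`-invariant subspaces)

HONEST FRAMING: venture file (cell `pub-ymgap`, track (a), seat p2); algebraic plumbing towards a
kernel proof of the multi-link Bakry–Émery Poincaré inequality on `SU(N)^E` — the substitute for
elliptic regularity is, as in the one-link tree file `SUNBakryEmeryPoincare.lean` Part F, the scale
of finite-dimensional spaces `𝒫_n` of real polynomials of degree `≤ n` in the real coordinates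
`Re Q_e[a,b]`, `Im Q_e[a,b]` of ALL links, which contain the constants and the coordinates, are
closed under products (degrees add) and — the key point — invariant under every left-invariant
derivative `D_A` (`A ∈ (E → M_N(ℂ))` arbitrary: `D_A` maps a coordinate to a linear function),
hence under `Γ` and `Δ`. Proofs copied from the one-link file with the coordinate index enlarged
to `E × (Fin N × Fin N × Bool)`.

## References

* Tree file `SUNBakryEmeryPoincare.lean`, Part F.
-/

noncomputable section

open scoped Matrix ComplexConjugate BigOperators Matrix.Norms.Frobenius ContDiff Topology
open Matrix Complex Finset
open Literature.MathematicalPhysics.QuantumFieldTheory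
open Literature.MathematicalPhysics.QuantumFieldTheory.SUNBakryEmery
  (FrameIdx frame CoordIdx coordMat coordFn coordFn_true coordFn_false re_trace_mul_eq_sum reTrMul reTrMul_apply)

namespace Summit.Ventures.YMGap

namespace LatticeBakryEmery

universe u

variable {ι : Type u} [Fintype ι] [DecidableEq ι] {N : ℕ}

/-! ### Real coordinates of `(E → M_N(ℂ))` -/

/-- Index set of the real coordinates `Re Q_e[a,b]`, `Im Q_e[a,b]`: a link and a one-link
coordinate index. -/
abbrev PCoordIdx (ι : Type u) (N : ℕ) : Type u := ι × CoordIdx N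

/-- The real coordinate functions `Q ↦ Re Q_e[a,b]`, `Q ↦ Im Q_e[a,b]`, written as `Re tr(Q_e M_κ)`. -/
def pcoordFn (κ : PCoordIdx ι N) : Cfg ι N → ℝ := fun Q => (Q κ.1 * coordMat κ.2).trace.re

omit [Fintype ι] [DecidableEq ι] in
/-- `pcoordFn (e, κ) Q = coordFn κ (Q e)`. -/
theorem pcoordFn_apply (κ : PCoordIdx ι N) (Q : Cfg ι N) : pcoordFn κ Q = coordFn κ.2 (Q κ.1) := rfl

/-- The real-linear function `Q ↦ Re tr(Q_e M)` as a continuous linear map on `(E → M_N(ℂ))`. -/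
def pReTrMul (e : ι) (M : Matrix (Fin N) (Fin N) ℂ) : Cfg ι N →L[ℝ] ℝ :=
  (reTrMul M).comp (ContinuousLinearMap.proj (R := ℝ) (φ := fun _ : ι => Matrix (Fin N) (Fin N) ℂ) e)

omit [Fintype ι] [DecidableEq ι] in
/-- Evaluation of `pReTrMul`. -/
@[simp] theorem pReTrMul_apply (e : ι) (M : Matrix (Fin N) (Fin N) ℂ) (Q : Cfg ι N) :
    pReTrMul e M Q = (Q e * M).trace.re := rfl

omit [DecidableEq ι] in
/-- `Q ↦ Re tr(Q_e M)` is smooth. -/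
theorem contDiff_pReTrMul (e : ι) (M : Matrix (Fin N) (Fin N) ℂ) :
    ContDiff ℝ ∞ fun Q : Cfg ι N => (Q e * M).trace.re :=
  (pReTrMul e M).contDiff

omit [DecidableEq ι] in
/-- `D_A Re tr((·)_e M) = Re tr((·)_e A_e M)`. -/
theorem algD_pReTrMul (A : Cfg ι N) (e : ι) (M : Matrix (Fin N) (Fin N) ℂ) :
    algD A (fun Q : Cfg ι N => (Q e * M).trace.re) = fun Q => (Q e * (A e * M)).trace.re := by
  funext Q
  have h := congrFun (algD_clm (pReTrMul e M) A) Q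
  refine h.trans ?_
  show ((Q * A) e * M).trace.re = _
  rw [Pi.mul_apply, Matrix.mul_assoc]

omit [Fintype ι] [DecidableEq ι] in
/-- The span of the coordinate functions contains all `Q ↦ Re tr(Q_e M)`. -/
theorem pReTrMul_mem_span_pcoordFn (e : ι) (M : Matrix (Fin N) (Fin N) ℂ) :
    (fun Q : Cfg ι N => (Q e * M).trace.re) ∈ Submodule.span ℝ (Set.range (pcoordFn (ι := ι) (N := N))) := by
  have h : (fun Q : Cfg ι N => (Q e * M).trace.re) =
      ∑ a, ∑ b, ((M b a).re • pcoordFn (e, (a, b, true)) + (-(M b a).im) • pcoordFn (e, (a, b, false))) := by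
    funext Q
    rw [re_trace_mul_eq_sum]
    simp only [Finset.sum_apply, Pi.add_apply, Pi.smul_apply, smul_eq_mul, pcoordFn_apply, coordFn_true,
      coordFn_false]
    exact sum_congr rfl fun a _ => sum_congr rfl fun b _ => by ring
  rw [h]
  refine Submodule.sum_mem _ fun a _ => Submodule.sum_mem _ fun b _ => Submodule.add_mem _ ?_ ?_
  · exact Submodule.smul_mem _ _ (Submodule.subset_span ⟨(e, (a, b, true)), rfl⟩)
  · exact Submodule.smul_mem _ _ (Submodule.subset_span ⟨(e, (a, b, false)), rfl⟩)

section Calculus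

omit [DecidableEq ι] in
/-- Coordinate functions are smooth. -/
theorem contDiff_pcoordFn (κ : PCoordIdx ι N) : ContDiff ℝ ∞ (pcoordFn κ) := contDiff_pReTrMul _ _

omit [DecidableEq ι] in
/-- `D_A` of a coordinate function is a linear function of the same link. -/
theorem algD_pcoordFn (A : Cfg ι N) (κ : PCoordIdx ι N) :
    algD A (pcoordFn κ) = fun Q => (Q κ.1 * (A κ.1 * coordMat κ.2)).trace.re :=
  algD_pReTrMul A κ.1 (coordMat κ.2)

end Calculus

/-! ### Monomials and the spaces `𝒫_n` -/

/-- The monomial `∏ᵢ coordinate_{κ i}`. -/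
def monom {k : ℕ} (κs : Fin k → PCoordIdx ι N) : Cfg ι N → ℝ := fun Q => ∏ i, pcoordFn (κs i) Q

variable (ι N) in
/-- **`𝒫_n`**: the real span of the monomials of degree `≤ n` in the real coordinates of
`(E → M_N(ℂ))` (restricted to `SU(N)^E` these are the polynomial functions of the compact group). -/
def polySpace (n : ℕ) : Submodule ℝ (Cfg ι N → ℝ) :=
  Submodule.span ℝ (Set.range fun p : (Σ k : Fin (n + 1), (Fin k → PCoordIdx ι N)) => monom p.2)

/-- `𝒫_n` is finite-dimensional. -/
instance polySpace.finiteDimensional (n : ℕ) : FiniteDimensional ℝ (polySpace ι N n) :=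
  FiniteDimensional.span_of_finite ℝ (Set.finite_range _)

omit [Fintype ι] [DecidableEq ι] in
/-- Monomials of degree `k ≤ n` lie in `𝒫_n`. -/
theorem monom_mem {n k : ℕ} (hk : k ≤ n) (κs : Fin k → PCoordIdx ι N) : monom κs ∈ polySpace ι N n :=
  Submodule.subset_span ⟨⟨⟨k, Nat.lt_succ_of_le hk⟩, κs⟩, rfl⟩

omit [Fintype ι] [DecidableEq ι] in
/-- `𝒫_n ⊆ 𝒫_{n'}` for `n ≤ n'`. -/
theorem polySpace_mono {n n' : ℕ} (h : n ≤ n') : polySpace ι N n ≤ polySpace ι N n' := by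
  refine Submodule.span_le.2 ?_
  rintro _ ⟨⟨k, κs⟩, rfl⟩
  exact monom_mem ((Nat.lt_succ_iff.1 k.2).trans h) κs

omit [Fintype ι] [DecidableEq ι] in
/-- `𝒫` is monotone. -/
theorem monotone_polySpace : Monotone (polySpace ι N) := fun _ _ h => polySpace_mono h

omit [Fintype ι] [DecidableEq ι] in
/-- Constants lie in `𝒫_n`. -/
theorem const_mem_polySpace (n : ℕ) (c : ℝ) : (fun _ : Cfg ι N => c) ∈ polySpace ι N n := by
  have h1 : (fun _ : Cfg ι N => (1 : ℝ)) ∈ polySpace ι N n := by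
    have h := monom_mem (n := n) (Nat.zero_le n) (Fin.elim0 : Fin 0 → PCoordIdx ι N)
    have e : monom (Fin.elim0 : Fin 0 → PCoordIdx ι N) = fun _ => (1 : ℝ) := by
      funext Q; simp [monom]
    rwa [e] at h
  have : (fun _ : Cfg ι N => c) = c • fun _ : Cfg ι N => (1 : ℝ) := by
    funext Q; simp
  rw [this]
  exact Submodule.smul_mem _ c h1

omit [Fintype ι] [DecidableEq ι] in
/-- Coordinate functions lie in `𝒫_n`, `n ≥ 1`. -/
theorem pcoordFn_mem_polySpace {n : ℕ} (hn : 1 ≤ n) (κ : PCoordIdx ι N) : pcoordFn κ ∈ polySpace ι N n := by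
  have h := monom_mem (n := n) hn (fun _ : Fin 1 => κ)
  have e : monom (fun _ : Fin 1 => κ) = pcoordFn κ := by
    funext Q; simp [monom]
  rwa [e] at h

omit [Fintype ι] [DecidableEq ι] in
/-- Linear functions `Q ↦ Re tr(Q_e M)` lie in `𝒫_n`, `n ≥ 1`. -/
theorem pReTrMul_mem_polySpace {n : ℕ} (hn : 1 ≤ n) (e : ι) (M : Matrix (Fin N) (Fin N) ℂ) :
    (fun Q : Cfg ι N => (Q e * M).trace.re) ∈ polySpace ι N n := by
  refine (Submodule.span_le.2 ?_) (pReTrMul_mem_span_pcoordFn e M)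
  rintro _ ⟨κ, rfl⟩
  exact pcoordFn_mem_polySpace hn κ

omit [DecidableEq ι] in
/-- Elements of `𝒫_n` are smooth. -/
theorem contDiff_of_mem_polySpace {n : ℕ} {f : Cfg ι N → ℝ} (hf : f ∈ polySpace ι N n) :
    ContDiff ℝ ∞ f := by
  induction hf using Submodule.span_induction with
  | mem x hx =>
      obtain ⟨⟨k, κs⟩, rfl⟩ := hx
      exact contDiff_prod fun i _ => contDiff_pcoordFn (κs i)
  | zero => exact contDiff_const
  | add x y _ _ hx hy => exact hx.add hy
  | smul c x _ hx => exact hx.const_smul c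

omit [Fintype ι] [DecidableEq ι] in
/-- Products of monomials are monomials. -/
theorem monom_mul_monom {k k' : ℕ} (κs : Fin k → PCoordIdx ι N) (κs' : Fin k' → PCoordIdx ι N) :
    monom κs * monom κs' = monom (Fin.append κs κs') := by
  funext Q
  simp only [Pi.mul_apply, monom, Fin.prod_univ_add, Fin.append_left, Fin.append_right]

omit [Fintype ι] [DecidableEq ι] in
/-- **`𝒫_a · 𝒫_b ⊆ 𝒫_{a+b}`**. -/
theorem mul_mem_polySpace {a b : ℕ} {f g : Cfg ι N → ℝ} (hf : f ∈ polySpace ι N a)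
    (hg : g ∈ polySpace ι N b) : f * g ∈ polySpace ι N (a + b) := by
  induction hf using Submodule.span_induction with
  | mem x hx =>
      obtain ⟨⟨k, κs⟩, rfl⟩ := hx
      induction hg using Submodule.span_induction with
      | mem y hy =>
          obtain ⟨⟨k', κs'⟩, rfl⟩ := hy
          rw [monom_mul_monom]
          exact monom_mem (Nat.add_le_add (Nat.lt_succ_iff.1 k.2) (Nat.lt_succ_iff.1 k'.2)) _
      | zero => rw [mul_zero]; exact Submodule.zero_mem _
      | add y z _ _ hy hz => rw [mul_add]; exact Submodule.add_mem _ hy hz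
      | smul c y _ hy => rw [mul_smul_comm]; exact Submodule.smul_mem _ c hy
  | zero => rw [zero_mul]; exact Submodule.zero_mem _
  | add x y _ _ hx hy => rw [add_mul]; exact Submodule.add_mem _ hx hy
  | smul c x _ hx => rw [smul_mul_assoc]; exact Submodule.smul_mem _ c hx

omit [Fintype ι] [DecidableEq ι] in
/-- `f ∈ 𝒫_a`, `g ∈ 𝒫_b`, `a + b ≤ n` ⇒ `f g ∈ 𝒫_n`. -/
theorem mul_mem_polySpace_of_le {a b n : ℕ} (h : a + b ≤ n) {f g : Cfg ι N → ℝ}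
    (hf : f ∈ polySpace ι N a) (hg : g ∈ polySpace ι N b) : f * g ∈ polySpace ι N n :=
  polySpace_mono h (mul_mem_polySpace hf hg)

omit [Fintype ι] [DecidableEq ι] in
/-- `𝒫_n` is closed under finite products with degrees adding up: `∏_{i<k} fᵢ ∈ 𝒫_{k d}` if each
`fᵢ ∈ 𝒫_d`. -/
theorem prod_mem_polySpace {k d : ℕ} {f : Fin k → Cfg ι N → ℝ} (hf : ∀ i, f i ∈ polySpace ι N d) :
    (fun Q => ∏ i, f i Q) ∈ polySpace ι N (k * d) := by
  induction k with
  | zero =>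
      simp only [Finset.univ_eq_empty, Finset.prod_empty, Nat.zero_mul]
      exact const_mem_polySpace 0 1
  | succ k ih =>
      have h1 := ih (f := fun i => f (Fin.castSucc i)) (fun i => hf _)
      have h2 := mul_mem_polySpace h1 (hf (Fin.last k))
      have e : (fun Q => ∏ i : Fin (k + 1), f i Q) = (fun Q => ∏ i : Fin k, f (Fin.castSucc i) Q) * f (Fin.last k) := by
        funext Q; simp only [Pi.mul_apply, Fin.prod_univ_castSucc]
      rw [e, show (k + 1) * d = k * d + d by ring]
      exact h2

section Calculus

omit [Fintype ι] [DecidableEq ι] in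
/-- A punctured monomial times a linear function lies in `𝒫_n`. -/
theorem erase_prod_mul_mem {n k : ℕ} (hk : k ≤ n) (κs : Fin k → PCoordIdx ι N) (i : Fin k)
    {ℓ : Cfg ι N → ℝ} (hℓ : ℓ ∈ Submodule.span ℝ (Set.range (pcoordFn (ι := ι) (N := N)))) :
    (fun Q => (∏ j ∈ univ.erase i, pcoordFn (κs j) Q) * ℓ Q) ∈ polySpace ι N n := by
  induction hℓ using Submodule.span_induction with
  | mem x hx =>
      obtain ⟨κ', rfl⟩ := hx
      have : (fun Q => (∏ j ∈ univ.erase i, pcoordFn (κs j) Q) * pcoordFn κ' Q) = monom (Function.update κs i κ') := by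
        funext Q
        have hupd : ∀ l, pcoordFn (Function.update κs i κ' l) Q =
            Function.update (fun l => pcoordFn (κs l) Q) i (pcoordFn κ' Q) l := fun l => by
          rw [Function.apply_update (fun _ κ => pcoordFn κ Q) κs i κ' l]
        simp only [monom, hupd, Finset.prod_update_of_mem (mem_univ i), Finset.sdiff_singleton_eq_erase]
        ring
      rw [this]
      exact monom_mem hk _
  | zero => simp only [Pi.zero_apply, mul_zero]; exact Submodule.zero_mem _
  | add x y _ _ hx hy =>
      have : (fun Q => (∏ j ∈ univ.erase i, pcoordFn (κs j) Q) * (x + y) Q) =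
          (fun Q => (∏ j ∈ univ.erase i, pcoordFn (κs j) Q) * x Q) +
            fun Q => (∏ j ∈ univ.erase i, pcoordFn (κs j) Q) * y Q := by
        funext Q; simp only [Pi.add_apply]; ring
      rw [this]; exact Submodule.add_mem _ hx hy
  | smul c x _ hx =>
      have : (fun Q => (∏ j ∈ univ.erase i, pcoordFn (κs j) Q) * (c • x) Q) =
          c • fun Q => (∏ j ∈ univ.erase i, pcoordFn (κs j) Q) * x Q := by
        funext Q; simp only [Pi.smul_apply, smul_eq_mul]; ring
      rw [this]; exact Submodule.smul_mem _ c hx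

omit [DecidableEq ι] in
/-- `D_A` of a monomial. -/
theorem algD_monom {k : ℕ} (A : Cfg ι N) (κs : Fin k → PCoordIdx ι N) :
    algD A (monom κs) = fun Q => ∑ i, (∏ j ∈ univ.erase i, pcoordFn (κs j) Q) * algD A (pcoordFn (κs i)) Q := by
  funext Q
  rw [algD_apply, show monom κs = (∏ i ∈ univ, pcoordFn (κs i) ·) from rfl,
    fderiv_finsetProd fun i _ => ((contDiff_pcoordFn (κs i)).differentiable (by simp)) Q]
  rw [_root_.sum_apply]
  refine sum_congr rfl fun i _ => ?_
  rw [_root_.smul_apply, smul_eq_mul, algD_apply]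

omit [DecidableEq ι] in
/-- **`𝒫_n` is invariant under every `D_A`** (`A ∈ (E → M_N(ℂ))` arbitrary). -/
theorem algD_mem_polySpace {n : ℕ} (A : Cfg ι N) {f : Cfg ι N → ℝ}
    (hf : f ∈ polySpace ι N n) : algD A f ∈ polySpace ι N n := by
  suffices h : ContDiff ℝ ∞ f ∧ algD A f ∈ polySpace ι N n from h.2
  induction hf using Submodule.span_induction with
  | mem x hx =>
      obtain ⟨⟨k, κs⟩, rfl⟩ := hx
      refine ⟨contDiff_of_mem_polySpace (monom_mem (n := k) le_rfl κs), ?_⟩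
      rw [algD_monom]
      have hfn : (fun Q => ∑ i, (∏ j ∈ univ.erase i, pcoordFn (κs j) Q) * algD A (pcoordFn (κs i)) Q) =
          ∑ i, fun Q => (∏ j ∈ univ.erase i, pcoordFn (κs j) Q) * algD A (pcoordFn (κs i)) Q := by
        funext Q; simp only [Finset.sum_apply]
      rw [hfn]
      refine Submodule.sum_mem _ fun i _ => ?_
      have hk : (k : ℕ) ≤ n := Nat.lt_succ_iff.1 k.2
      have hlin : algD A (pcoordFn (κs i)) ∈ Submodule.span ℝ (Set.range (pcoordFn (ι := ι) (N := N))) := by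
        rw [algD_pcoordFn]
        exact pReTrMul_mem_span_pcoordFn _ _
      exact erase_prod_mul_mem hk κs i hlin
  | zero =>
      refine ⟨contDiff_const, ?_⟩
      have h0 : algD A (0 : Cfg ι N → ℝ) = 0 := algD_const 0 A
      rw [h0]
      exact Submodule.zero_mem _
  | add x y _ _ hx hy =>
      exact ⟨hx.1.add hy.1, by rw [algD_add hx.1 hy.1]; exact Submodule.add_mem _ hx.2 hy.2⟩
  | smul c x _ hx =>
      refine ⟨hx.1.const_smul c, ?_⟩
      have : algD A (c • x) = c • algD A x := by
        show algD A (fun Q => c * x Q) = fun Q => c * algD A x Q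
        exact algD_const_mul hx.1 c A
      rw [this]
      exact Submodule.smul_mem _ c hx.2

/-- `Δ 𝒫_n ⊆ 𝒫_n`. -/
theorem Lap_mem_polySpace {n : ℕ} {f : Cfg ι N → ℝ} (hf : f ∈ polySpace ι N n) :
    Lap f ∈ polySpace ι N n := by
  have : Lap f = ∑ a : BIdx ι N, algD (bframe a) (algD (bframe a) f) := by
    funext Q; simp only [Lap, Finset.sum_apply]
  rw [this]
  exact Submodule.sum_mem _ fun a _ => algD_mem_polySpace _ (algD_mem_polySpace _ hf)

/-- `Γ(𝒫_a, 𝒫_b) ⊆ 𝒫_{a+b}`. -/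
theorem Gam_mem_polySpace {a b : ℕ} {f g : Cfg ι N → ℝ} (hf : f ∈ polySpace ι N a)
    (hg : g ∈ polySpace ι N b) : Gam f g ∈ polySpace ι N (a + b) := by
  have : Gam f g = ∑ c : BIdx ι N, algD (bframe c) f * algD (bframe c) g := by
    funext Q; simp only [Gam, Finset.sum_apply, Pi.mul_apply]
  rw [this]
  exact Submodule.sum_mem _ fun c _ => mul_mem_polySpace (algD_mem_polySpace _ hf) (algD_mem_polySpace _ hg)

/-- `L_S 𝒫_n ⊆ 𝒫_{n + d}` for `S ∈ 𝒫_d`. -/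
theorem genL_mem_polySpace {n dS : ℕ} {S f : Cfg ι N → ℝ} (hS : S ∈ polySpace ι N dS)
    (hf : f ∈ polySpace ι N n) : genL S f ∈ polySpace ι N (n + dS) := by
  have : genL S f = Lap f + Gam S f := by funext Q; rfl
  rw [this]
  refine Submodule.add_mem _ (polySpace_mono (Nat.le_add_right _ _) (Lap_mem_polySpace hf)) ?_
  have h := Gam_mem_polySpace hS hf
  rwa [add_comm] at h

end Calculus

end LatticeBakryEmery

end Summit.Ventures.YMGap
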